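/-
Origin: expansion seat `planner-pub-hodgecm-mc-axioms-1-g14-0`, handover #W50 2026-08-20T15:53:55Z md5 280076115edc (PKG ab4f7157769b → 280076115edc; 134 l.; MECHANICAL (iib-R) rewrite v3.1 of the PKG file as it stands (90 token edits; rules R1x1+RX[h₂]x89)) (`HOME/mc/pub-hodgecm-mc-axioms-1-g14/revendor/kit-r55/stage55/HodgeCM/Model/E2InstanceR20AE.lean`, md5 280076115edc, 134 lines);
landed by the gen-22 packager (p-g22) in gate run 55 REPLACES the earlier landed copy of `HodgeCM/Model/E2InstanceR20AE.lean` (seat copy carried the packager Origin header of an earlier run (stripped)).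
-/
/-
Origin: CONSTRUCTION seat `planner-pub-hodgecm-mc-glue-1-g9-0` (unit pub-hodgecm-mc-glue-1-g9, gen 9 of mc-glue-1, node E ASSEMBLER),
2026-08-20.  RUN-40 CANDIDATE, GENERATED MECHANICALLY (`HOME/mc/pub-hodgecm-mc-glue-1-g9/tools/gen_r20ae.py`) FROM THE
INSTALLED `E2InstanceR19AE.lean` (RUN 38 #362, md5 b1da5adc6670).
NEW additive leaf `HodgeCM/Model/E2InstanceR20AE.lean`: `perL_picardCM_r20AE` = the E term of record `perL_picardCM_r19AE`
with BINDER-OWNERS row 15 `hk` RE-TYPED TO THE ALONG-FORM ((ρ1-E), booked glue-1/axioms-3 2026-08-19T22:55:41Z):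
(REP) is asked only ALONG the two coordinate directions `-i • e_p` (`p : Fin 2`) of `𝔭 ≅ ℂ²` —
`∀ … (p : Fin 2), (C V c hV hc h6 k hk N hN).IsPMinusKilledAlong BallForms.expP (-Complex.I • Pi.single p 1)` —
instead of along every direction `v` (`IsPMinusKilled = ∀ v, IsPMinusKilledAlong … v`, `ArchKTypeData.isPMinusKilled_iff`).
This is a WEAKER hypothesis (hence a stronger theorem): the same term as the `hk` binder of theta-3's END-STATE corollary
`classPacksOf_pin_of_isPMinusKilledAlong` (`Model/ThetaHolDirections`, RUN 34; there with `BallForms.expP` under `open`) and the conclusion shape of carch-1's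
#CA14 r2 `isPMinusKilledAlong_archKTypeOfSlotZeroRec/OneRec_of_embedding_eq` (RUN 39); every other binder VERBATIM;
15 binder groups `h hA W S μ hR hsmall C hT hpd hk gen12 real34 hyp12 hyp34` (count unchanged, KIND tally unchanged).
Proof = ONE application of the revision-13 core `perL_picardCM_r13core` with E's binder `hol` ASSEMBLED by
`ArchKTypeData.hol_of_isPMinusKilledAlong` ((H1) `hT`, (AN) `hpd`, (REP-along) `hk`; the reduction is theta-3's
`isWeaklyCR_of_isPMinusKilledAlong`: the set where the real-linear scalarised differential commutes with `i` is a complex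
subspace containing `e_0, e_1`) and the chain's four substitutions made exactly as `r15A`/`r15AE`/`r18AE`/`r19AE` make them:
`hHR := BettiUniverse.HodgeRiemann20_holds`, `hBetti := embBettiSideOf …`, `h31 := fact_cmInflation_riemann … hR`,
`hLiu := hLiu_of_smallLevel … hsmall`, `h₃ ↦ cmAbelianVarietyRealised_of_eigenbasis hHD hI h₃`.
INSTALL ORDER: after `E2InstanceR19AE` (RUN 38) and `ThetaHolDirections` (RUN 34) — both installed.  Leaf: nothing imports it;
drop alone.  KERNEL only: 1 theorem, 0 defs, no proof holes, no cite records, nothing of PerL / QW8 / the 2001 programme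
is used; expected `#print axioms` = {propext, Classical.choice, Quot.sound}.
-/
import Summits.HodgeConjecture.HodgeCM.Model.E2InstanceR19AE
import Summits.HodgeConjecture.HodgeCM.Model.ThetaHolDirections

/-!
# E2 instance, revision 20AE — the record term with row `hk` in the ALONG-FORM (two coordinate directions)

`Model.perL_picardCM_r19AE` (E term of record after RUN 38, 15 binders) asks in row 15

  `hk : ∀ V c hV hc h6 k hk N hN, (C V c hV hc h6 k hk N hN).IsPMinusKilled BallForms.expP`

— annihilation by `𝔭₋` along EVERY direction of the chart `expP : ℂ² → U(2,1)`.  theta-3's `Model/ThetaHolDirections`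
(node W6b-hol (ASM), pin side) proved that (AN) `hpd` + (REP) along the two coordinate directions `-i • e_0`, `-i • e_1`
already give E's `hol` (`ArchKTypeData.hol_of_isPMinusKilledAlong`).  This leaf moves that reduction INTO THE E TERM:

* `Model.perL_picardCM_r20AE` : `(picardCMUniverse hHD hI h₁ (cmAbelianVarietyRealised_of_eigenbasis hHD hI h₃)).PerL`
  under revision 19AE's binders VERBATIM except row 15:
  `hk : ∀ V c hV hc h6 k hk N hN (p : Fin 2), (C V c hV hc h6 k hk N hN).IsPMinusKilledAlong BallForms.expP (-Complex.I • Pi.single p 1)`.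

Why: the honest `C`-lane terms (carch-1 `archKTypeOfSlotZeroRec/OneRec`, #CA14 r2) prove (REP) in exactly this Along-form,
one coordinate direction at a time, from the one-parameter subgroups `t ↦ expP ((-i t) e_p)` / `t ↦ expP (t e_p)`; the
all-directions form would ask them for Schwartz-topology limits along every `v`, which nothing downstream needs.
-/

noncomputable section

open scoped TensorProduct InnerProductSpace Matrix

namespace HodgeCM

namespace Model

open HodgeCM.Universe (AdelicThetaCore AdelicThetaCore₀ SideData ThetaModel ModelAxiomsPerL)
open Literature.AlgebraicGeometry.HodgeTheory
open Literature.AlgebraicGeometry.ComplexMultiplication (Shimura1998_Thm3_isogenousPower Shimura1998_Thm2_Cor)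
open Literature.NumberTheory.Automorphic.PicardCM
open Literature.NumberTheory.Transcendental (Arapura2012_Cor_15_4_6)
open HodgeCM.CMTypeOps (inflate)
open HodgeCM.Model.SupplyResidual (ClassSupplyPackN)
open HodgeCM.Model.ThetaSpace

variable (hHD : exists_isReal_hodgeModel) (hI : hodgePQ_independent_of_hodgeModel)
  (h₁ : BallQuotientUniformised)  (h₃ : CMAbelianVarietyEigenbasisRealised)

/-- **E2 instance, revision 20AE — `Model.perL_picardCM_r19AE` with row 15 `hk` in the ALONG-FORM.**
Row 15 now reads `∀ … (p : Fin 2), (C V c hV hc h6 k hk N hN).IsPMinusKilledAlong BallForms.expP (-Complex.I • Pi.single p 1)`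
((REP) along the two coordinate directions only; weaker than `IsPMinusKilled = ∀ v, IsPMinusKilledAlong … v`).  All other
binders verbatim from revision 19AE (15 binder groups `h hA W S μ hR hsmall C hT hpd hk gen12 real34 hyp12 hyp34`).
Proof: the revision-13 core with `hol := (C …).hol_of_isPMinusKilledAlong … (hT …) (hpd …) (fun p => hk … p)` and
`hHR`/`hBetti`/`h31`/`hLiu`/`h₃` substituted as in revisions 15A, 15AE, 18AE, 19AE. -/
theorem perL_picardCM_r20AE (h : Bool)
    (hA : Arapura2012_Cor_15_4_6)
    (W : ∀ {L : CMField} {ι₁ : L →+* ℂ} (V : HermSpace3 L ι₁) (c : SeesawCtx L), WmInput V c.D)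
    (S : ∀ {L : CMField} {ι₁ : L →+* ℂ} (V : HermSpace3 L ι₁) (c : SeesawCtx L), ThetaAdelicSide V c)
    (μ : ∀ {L : CMField}, SeesawCtx L → Fin 4 → NumberField.InfinitePlace L → ℤ)
    (hR : DeligneMilne1982_Thm_6_20_full)
    (hsmall : ∀ {L : CMField} {ι₁ : L →+* ℂ} (V : HermSpace3 L ι₁) (c : SeesawCtx L),
      (thetaModelOf hHD hI h₁ (cmAbelianVarietyRealised_of_eigenbasis hHD hI h₃) h (embOf hHD hI h₁ (cmAbelianVarietyRealised_of_eigenbasis hHD hI h₃)) (coverOf hHD hI h₁ (cmAbelianVarietyRealised_of_eigenbasis hHD hI h₃) hA) (wmOfInput W) (thetaOf _ (thetaClassInputOf _ (fun V c => thetaSpaceInputOf hHD hI h₁ (cmAbelianVarietyRealised_of_eigenbasis hHD hI h₃) S V c))) (d12Of μ) (d34Of μ)).GoodCtx ι₁ c → Module.finrank ℚ c.K = 6 →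
      ∀ i : Fin 4, ∃ Γ₀ : Level V, ∀ Γ ≤ Γ₀,
        ∃ (M : CMField) (k : c.K →+* M) (σ' : M →+* ℂ), σ'.comp k = c.σ ∧
        (thetaModelOf hHD hI h₁ (cmAbelianVarietyRealised_of_eigenbasis hHD hI h₃) h (embOf hHD hI h₁ (cmAbelianVarietyRealised_of_eigenbasis hHD hI h₃)) (coverOf hHD hI h₁ (cmAbelianVarietyRealised_of_eigenbasis hHD hI h₃) hA) (wmOfInput W) (thetaOf _ (thetaClassInputOf _ (fun V c => thetaSpaceInputOf hHD hI h₁ (cmAbelianVarietyRealised_of_eigenbasis hHD hI h₃) S V c))) (d12Of μ) (d34Of μ)).Theta V c i Γ ⊆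
          (picardCMUniverse hHD hI h₁ (cmAbelianVarietyRealised_of_eigenbasis hHD hI h₃)).Uiso Γ M (inflate k (c.Ψ i)) σ')
    (C : ∀ {L : CMField} {ι₁ : L →+* ℂ} (V : HermSpace3 L ι₁) (c : SeesawCtx L) (hV : IsAnisotropic L V.Hm),
      (thetaModelOf hHD hI h₁ (cmAbelianVarietyRealised_of_eigenbasis hHD hI h₃) h (embOf hHD hI h₁ (cmAbelianVarietyRealised_of_eigenbasis hHD hI h₃)) (coverOf hHD hI h₁ (cmAbelianVarietyRealised_of_eigenbasis hHD hI h₃) hA) (wmOfInput W) (thetaOf _ (thetaClassInputOf _ (fun V c => thetaSpaceInputOf hHD hI h₁ (cmAbelianVarietyRealised_of_eigenbasis hHD hI h₃) S V c))) (d12Of μ) (d34Of μ)).GoodCtx ι₁ c →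
      Module.finrank ℚ c.K = 6 → ∀ k : Fin 4, k = 0 ∨ k = 1 → ∀ N : ℕ, 0 < N →
        ArchKTypeData (thetaSpaceInputIn hHD hI h₁ (cmAbelianVarietyRealised_of_eigenbasis hHD hI h₃) (S V c) hV) k N)
    (hT : ∀ {L : CMField} {ι₁ : L →+* ℂ} (V : HermSpace3 L ι₁) (c : SeesawCtx L) (k : Fin 4) (N : ℕ),
      ((S V c).P k).IsThetaArchContinuous N)
    (hpd : ∀ {L : CMField} {ι₁ : L →+* ℂ} (V : HermSpace3 L ι₁) (c : SeesawCtx L) (hV : IsAnisotropic L V.Hm)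
      (hc : (thetaModelOf hHD hI h₁ (cmAbelianVarietyRealised_of_eigenbasis hHD hI h₃) h (embOf hHD hI h₁ (cmAbelianVarietyRealised_of_eigenbasis hHD hI h₃)) (coverOf hHD hI h₁ (cmAbelianVarietyRealised_of_eigenbasis hHD hI h₃) hA) (wmOfInput W) (thetaOf _ (thetaClassInputOf _ (fun V c => thetaSpaceInputOf hHD hI h₁ (cmAbelianVarietyRealised_of_eigenbasis hHD hI h₃) S V c))) (d12Of μ) (d34Of μ)).GoodCtx ι₁ c)
      (h6 : Module.finrank ℚ c.K = 6) (k : Fin 4) (hk : k = 0 ∨ k = 1) (N : ℕ) (hN : 0 < N),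
      (C V c hV hc h6 k hk N hN).IsWeaklyPDiff Literature.AlgebraicGeometry.ShimuraVarieties.BallForms.expP)
    (hk : ∀ {L : CMField} {ι₁ : L →+* ℂ} (V : HermSpace3 L ι₁) (c : SeesawCtx L) (hV : IsAnisotropic L V.Hm)
      (hc : (thetaModelOf hHD hI h₁ (cmAbelianVarietyRealised_of_eigenbasis hHD hI h₃) h (embOf hHD hI h₁ (cmAbelianVarietyRealised_of_eigenbasis hHD hI h₃)) (coverOf hHD hI h₁ (cmAbelianVarietyRealised_of_eigenbasis hHD hI h₃) hA) (wmOfInput W) (thetaOf _ (thetaClassInputOf _ (fun V c => thetaSpaceInputOf hHD hI h₁ (cmAbelianVarietyRealised_of_eigenbasis hHD hI h₃) S V c))) (d12Of μ) (d34Of μ)).GoodCtx ι₁ c)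
      (h6 : Module.finrank ℚ c.K = 6) (k : Fin 4) (hk : k = 0 ∨ k = 1) (N : ℕ) (hN : 0 < N) (p : Fin 2),
      (C V c hV hc h6 k hk N hN).IsPMinusKilledAlong Literature.AlgebraicGeometry.ShimuraVarieties.BallForms.expP
        (-Complex.I • (Pi.single p 1 : Fin 2 → ℂ)))
    (gen12 : ∀ {L : CMField} {ι₁ : L →+* ℂ} (V : HermSpace3 L ι₁) (c : SeesawCtx L),
      (thetaModelOf hHD hI h₁ (cmAbelianVarietyRealised_of_eigenbasis hHD hI h₃) h (embOf hHD hI h₁ (cmAbelianVarietyRealised_of_eigenbasis hHD hI h₃)) (coverOf hHD hI h₁ (cmAbelianVarietyRealised_of_eigenbasis hHD hI h₃) hA) (wmOfInput W) (thetaOf _ (thetaClassInputOf _ (fun V c => thetaSpaceInputOf hHD hI h₁ (cmAbelianVarietyRealised_of_eigenbasis hHD hI h₃) S V c))) (d12Of μ) (d34Of μ)).GoodCtx ι₁ c → Module.finrank ℚ c.K = 6 →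
      Nonempty ((thetaModelOf hHD hI h₁ (cmAbelianVarietyRealised_of_eigenbasis hHD hI h₃) h (embOf hHD hI h₁ (cmAbelianVarietyRealised_of_eigenbasis hHD hI h₃)) (coverOf hHD hI h₁ (cmAbelianVarietyRealised_of_eigenbasis hHD hI h₃) hA) (wmOfInput W) (thetaOf _ (thetaClassInputOf _ (fun V c => thetaSpaceInputOf hHD hI h₁ (cmAbelianVarietyRealised_of_eigenbasis hHD hI h₃) S V c))) (d12Of μ) (d34Of μ)).Gen12FunBridge V c))
    (real34 : ∀ {L : CMField} {ι₁ : L →+* ℂ} (V : HermSpace3 L ι₁) (c : SeesawCtx L),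
      (thetaModelOf hHD hI h₁ (cmAbelianVarietyRealised_of_eigenbasis hHD hI h₃) h (embOf hHD hI h₁ (cmAbelianVarietyRealised_of_eigenbasis hHD hI h₃)) (coverOf hHD hI h₁ (cmAbelianVarietyRealised_of_eigenbasis hHD hI h₃) hA) (wmOfInput W) (thetaOf _ (thetaClassInputOf _ (fun V c => thetaSpaceInputOf hHD hI h₁ (cmAbelianVarietyRealised_of_eigenbasis hHD hI h₃) S V c))) (d12Of μ) (d34Of μ)).GoodCtx ι₁ c → Module.finrank ℚ c.K = 6 →
      Nonempty ((thetaModelOf hHD hI h₁ (cmAbelianVarietyRealised_of_eigenbasis hHD hI h₃) h (embOf hHD hI h₁ (cmAbelianVarietyRealised_of_eigenbasis hHD hI h₃)) (coverOf hHD hI h₁ (cmAbelianVarietyRealised_of_eigenbasis hHD hI h₃) hA) (wmOfInput W) (thetaOf _ (thetaClassInputOf _ (fun V c => thetaSpaceInputOf hHD hI h₁ (cmAbelianVarietyRealised_of_eigenbasis hHD hI h₃) S V c))) (d12Of μ) (d34Of μ)).Real34FunBridge V c))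
    (hyp12 : ∀ {L : CMField} {ι₁ : L →+* ℂ} (V : HermSpace3 L ι₁) (c : SeesawCtx L),
      (thetaModelOf hHD hI h₁ (cmAbelianVarietyRealised_of_eigenbasis hHD hI h₃) h (embOf hHD hI h₁ (cmAbelianVarietyRealised_of_eigenbasis hHD hI h₃)) (coverOf hHD hI h₁ (cmAbelianVarietyRealised_of_eigenbasis hHD hI h₃) hA) (wmOfInput W) (thetaOf _ (thetaClassInputOf _ (fun V c => thetaSpaceInputOf hHD hI h₁ (cmAbelianVarietyRealised_of_eigenbasis hHD hI h₃) S V c))) (d12Of μ) (d34Of μ)).GoodCtx ι₁ c → Module.finrank ℚ c.K = 6 →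
      Nonempty (((coreOf _ (embOf hHD hI h₁ (cmAbelianVarietyRealised_of_eigenbasis hHD hI h₃)) (coverOf hHD hI h₁ (cmAbelianVarietyRealised_of_eigenbasis hHD hI h₃) hA) (wmOfInput W) (thetaOf _ (thetaClassInputOf _ (fun V c => thetaSpaceInputOf hHD hI h₁ (cmAbelianVarietyRealised_of_eigenbasis hHD hI h₃) S V c)))).toCore h).HypSmoothCore12
        (((coreOf _ (embOf hHD hI h₁ (cmAbelianVarietyRealised_of_eigenbasis hHD hI h₃)) (coverOf hHD hI h₁ (cmAbelianVarietyRealised_of_eigenbasis hHD hI h₃) hA) (wmOfInput W) (thetaOf _ (thetaClassInputOf _ (fun V c => thetaSpaceInputOf hHD hI h₁ (cmAbelianVarietyRealised_of_eigenbasis hHD hI h₃) S V c)))).toCore h).side12 (d12Of μ)) (((coreOf _ (embOf hHD hI h₁ (cmAbelianVarietyRealised_of_eigenbasis hHD hI h₃)) (coverOf hHD hI h₁ (cmAbelianVarietyRealised_of_eigenbasis hHD hI h₃) hA) (wmOfInput W) (thetaOf _ (thetaClassInputOf _ (fun V c => thetaSpaceInputOf hHD hI h₁ (cmAbelianVarietyRealised_of_eigenbasis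 hHD hI h₃) S V c)))).toCore h).side34 (d34Of μ))
        ((((coreOf _ (embOf hHD hI h₁ (cmAbelianVarietyRealised_of_eigenbasis hHD hI h₃)) (coverOf hHD hI h₁ (cmAbelianVarietyRealised_of_eigenbasis hHD hI h₃) hA) (wmOfInput W) (thetaOf _ (thetaClassInputOf _ (fun V c => thetaSpaceInputOf hHD hI h₁ (cmAbelianVarietyRealised_of_eigenbasis hHD hI h₃) S V c)))).toCore h).analyticKM (((coreOf _ (embOf hHD hI h₁ (cmAbelianVarietyRealised_of_eigenbasis hHD hI h₃)) (coverOf hHD hI h₁ (cmAbelianVarietyRealised_of_eigenbasis hHD hI h₃) hA) (wmOfInput W) (thetaOf _ (thetaClassInputOf _ (fun V c => thetaSpaceInputOf hHD hI h₁ (cmAbelianVarietyRealised_of_eigenbasis hHD hI h₃) S V c)))).toCore h).side12 (d12Of μ))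
          (((coreOf _ (embOf hHD hI h₁ (cmAbelianVarietyRealised_of_eigenbasis hHD hI h₃)) (coverOf hHD hI h₁ (cmAbelianVarietyRealised_of_eigenbasis hHD hI h₃) hA) (wmOfInput W) (thetaOf _ (thetaClassInputOf _ (fun V c => thetaSpaceInputOf hHD hI h₁ (cmAbelianVarietyRealised_of_eigenbasis hHD hI h₃) S V c)))).toCore h).side34 (d34Of μ))).toAnalytic) V c (ℓ := linOfInput W V c)))
    (hyp34 : ∀ {L : CMField} {ι₁ : L →+* ℂ} (V : HermSpace3 L ι₁) (c : SeesawCtx L),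
      (thetaModelOf hHD hI h₁ (cmAbelianVarietyRealised_of_eigenbasis hHD hI h₃) h (embOf hHD hI h₁ (cmAbelianVarietyRealised_of_eigenbasis hHD hI h₃)) (coverOf hHD hI h₁ (cmAbelianVarietyRealised_of_eigenbasis hHD hI h₃) hA) (wmOfInput W) (thetaOf _ (thetaClassInputOf _ (fun V c => thetaSpaceInputOf hHD hI h₁ (cmAbelianVarietyRealised_of_eigenbasis hHD hI h₃) S V c))) (d12Of μ) (d34Of μ)).GoodCtx ι₁ c → Module.finrank ℚ c.K = 6 →
      Nonempty (((coreOf _ (embOf hHD hI h₁ (cmAbelianVarietyRealised_of_eigenbasis hHD hI h₃)) (coverOf hHD hI h₁ (cmAbelianVarietyRealised_of_eigenbasis hHD hI h₃) hA) (wmOfInput W) (thetaOf _ (thetaClassInputOf _ (fun V c => thetaSpaceInputOf hHD hI h₁ (cmAbelianVarietyRealised_of_eigenbasis hHD hI h₃) S V c)))).toCore h).HypSmoothCore34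
        (((coreOf _ (embOf hHD hI h₁ (cmAbelianVarietyRealised_of_eigenbasis hHD hI h₃)) (coverOf hHD hI h₁ (cmAbelianVarietyRealised_of_eigenbasis hHD hI h₃) hA) (wmOfInput W) (thetaOf _ (thetaClassInputOf _ (fun V c => thetaSpaceInputOf hHD hI h₁ (cmAbelianVarietyRealised_of_eigenbasis hHD hI h₃) S V c)))).toCore h).side12 (d12Of μ)) (((coreOf _ (embOf hHD hI h₁ (cmAbelianVarietyRealised_of_eigenbasis hHD hI h₃)) (coverOf hHD hI h₁ (cmAbelianVarietyRealised_of_eigenbasis hHD hI h₃) hA) (wmOfInput W) (thetaOf _ (thetaClassInputOf _ (fun V c => thetaSpaceInputOf hHD hI h₁ (cmAbelianVarietyRealised_of_eigenbasis hHD hI h₃) S V c)))).toCore h).side34 (d34Of μ))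
        ((((coreOf _ (embOf hHD hI h₁ (cmAbelianVarietyRealised_of_eigenbasis hHD hI h₃)) (coverOf hHD hI h₁ (cmAbelianVarietyRealised_of_eigenbasis hHD hI h₃) hA) (wmOfInput W) (thetaOf _ (thetaClassInputOf _ (fun V c => thetaSpaceInputOf hHD hI h₁ (cmAbelianVarietyRealised_of_eigenbasis hHD hI h₃) S V c)))).toCore h).analyticKM (((coreOf _ (embOf hHD hI h₁ (cmAbelianVarietyRealised_of_eigenbasis hHD hI h₃)) (coverOf hHD hI h₁ (cmAbelianVarietyRealised_of_eigenbasis hHD hI h₃) hA) (wmOfInput W) (thetaOf _ (thetaClassInputOf _ (fun V c => thetaSpaceInputOf hHD hI h₁ (cmAbelianVarietyRealised_of_eigenbasis hHD hI h₃) S V c)))).toCore h).side12 (d12Of μ))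
          (((coreOf _ (embOf hHD hI h₁ (cmAbelianVarietyRealised_of_eigenbasis hHD hI h₃)) (coverOf hHD hI h₁ (cmAbelianVarietyRealised_of_eigenbasis hHD hI h₃) hA) (wmOfInput W) (thetaOf _ (thetaClassInputOf _ (fun V c => thetaSpaceInputOf hHD hI h₁ (cmAbelianVarietyRealised_of_eigenbasis hHD hI h₃) S V c)))).toCore h).side34 (d34Of μ))).toAnalytic) V c (ℓ := linOfInput W V c))) :
     (picardCMUniverse hHD hI h₁ (cmAbelianVarietyRealised_of_eigenbasis hHD hI h₃)).PerL :=
  perL_picardCM_r13core hHD hI h₁ (cmAbelianVarietyRealised_of_eigenbasis hHD hI h₃) BettiUniverse.HodgeRiemann20_holds h hA W S μ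
    (embBettiSideOf hHD hI h₁ (cmAbelianVarietyRealised_of_eigenbasis hHD hI h₃))
    (fact_cmInflation_riemann hHD hI (cmAbelianVarietyRealised_of_eigenbasis hHD hI h₃) h₁ hR)
    (hLiu_of_smallLevel hHD hI h₁ (cmAbelianVarietyRealised_of_eigenbasis hHD hI h₃) h hA W S μ hsmall) C
    (fun V c hV hc h6 k hk' N hN =>
      (C V c hV hc h6 k hk' N hN).hol_of_isPMinusKilledAlong hHD hI h₁ (cmAbelianVarietyRealised_of_eigenbasis hHD hI h₃) (S V c) hV
        (hT V c k N) (hpd V c hV hc h6 k hk' N hN) (fun p => hk V c hV hc h6 k hk' N hN p))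
    gen12 real34 hyp12 hyp34

end Model

end HodgeCM
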